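/-
Copyright (c) 2026 the pub-hodgecm-mathlib formalisation cell (harness21).  Prover seat hodgecm-mathlib-LH10-p01 (g10): road «M6 ∕ F3 TOT-Λ BY OVER-ORDERS»
(LEAD T14-66; dealer LH4-plan (g8) WORD #77; F3-5 pen LH7-p04 (g11) 23:40:00Z «(ii) YES please», SIG-F3-2b (B3) delta 5a9da9c3b6f61ee7 item (ii)), carve (ii) «LEVEL FROM
PRINCIPALITY»: a glued over-order `G(N″, b, c′)` (`b ≥ 1`) whose `O₁`-slice is principal has character value of EXACT level `v(f(c′)) = v(ϖ)^b`, hence sits at one of the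
monogenic levels `Lvl(N″, b, c′)` of ★ F3-3 (UG); 2026-09-03.
-/
import Literature.NumberTheory.Automorphic.GluedOverOrders          -- ★ F3-1a (LH7-p04 (g11)): the glued sets `G(N″,b,c′)`, `gen_mem_glued`; brings ★ `coord_unique`
import Literature.NumberTheory.Automorphic.GluedOverOrderLevelLaw   -- ★ F3-3 FILE 1 (LH4-p01 (g9)): `char_and_valuation_eq_of_odd_level ∕ _even_level`, `mem_span_uniformizer_pow_iff_valuation_le`, `valuation_coe_eq_one_of_isUnit`, `span_uniformizer_pow_le_maximalIdeal`, `isUnit_of_sub_one_mem_maximalIdeal`, `valuation_coe_lt_one_of_mem_maximalIdeal`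
import HarnessLib

/-!
# The level of a glued over-order with principal slice: `v(c′² − ϖ^{N″}a c′ − ϖ^{2N″}k) = v(ϖ)^b`, hence `Lvl(N″, b, c′)`

Topic `NumberTheory/Automorphic`; namespace `Literature.NumberTheory.Automorphic`.  THEOREMS ONLY (no definition, no instance, no notation, no named fact, no `sorry`).
Cell `pub/hodgecm-mathlib` (D-0151), crux H413 = `stmt-HodgeConjecture-24833`; road M6 → F3 «TOT-Λ by over-orders», the step between ★ F3-2b (B3b) «the `O₁`-slice of the
multiplier order of a self-dual lattice is principal over `O_{N″}`» and ★ F3-3 (UG) `exists_unitary_generator_glued`'s level hypothesis `hlvl`.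

FRAME = ★ F3-1a `GluedOverOrders` (`j : 𝒪_E →+* O₁`, `θ² = j a θ + j k`, unique coordinates `hcoord`), the uniformiser spelled as in ★ F3-3 (`{ϖ : E} (hϖ : IsUniformizingElement ϖ)`,
`π = ⟨ϖ, hϖ.mem⟩ : 𝒪_E`), Eisenstein signs `a ∈ 𝔪`, `k ∈ 𝔪` (resp. `v(k) = v(ϖ)`).  `Π_{N″} = j(π^{N″})θ`, `f(c′) = c′² − (π^{N″}a c′ + π^{2N″}k)`,
`G = G(N″, b, c′) = {(y, j b₀ + j c₀ Π_{N″}) | y ≡ b₀ + c₀c′ (mod π^b)}` (spelled out as ★ F3-1a's set).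

* §1 `valuation_char_eq_of_slice_principal`: if `b ≥ 1`, `c′` is LAWFUL (`f(c′) ∈ (π^b)`) and the slice `{s | (0, s) ∈ G}` is PRINCIPAL (`= {g.2·ν | g ∈ G}`, ★ F3-2b (B3b)
  read in `𝒪_E × O₁`), then `v(f(c′)) = v(ϖ)^b`.  PROOF: the slice contains `j(π^b)`, `Π − j c′` and `ν`; so `s₁ν = j(π^b)`, `s₂ν = Π − j c′` (`sᵢ ∈ O_{N″}`), `ν` is a
  non-zero-divisor, and `ν = (j e·s₁ + j γ·s₂)ν` forces `e x₁ + γ x₂ = 1` on first coordinates — one of `x₁, x₂` is a unit.  From `s₂·j(π^b) = s₁·(Π − j c′)`: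
  `π^b y₂ = x₁ − y₁c′ + y₁π^{N″}a` and `π^b x₂ = −x₁c′ + y₁π^{2N″}k`, whence `y₁·f(c′) = −π^b(x₂ + c′y₂)`.  `c′ ∈ 𝔪` (lawful, `b ≥ 1`), so `x₁` a unit is absurd and `x₂` is a
  unit, `x₂ + c′y₂` too: `v(y₁)·v(f(c′)) = v(ϖ)^b` gives `≥`, lawfulness gives `≤`.
* §2 `level_of_valuation_char_eq`: `v(f(c′)) = v(ϖ)^b`, `b ≥ 1` ⇒ `(b = 2N″+1 ∧ c′ ∈ (π^{N″+1})) ∨ (∃ M, 1 ≤ M ≤ N″, b = 2M, c′ ∈ (π^M) ∖ (π^{M+1}))` — the `hlvl` of ★ (UG) in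
  `𝒪_E`-currency (★ F3-3 FILE 1's value laws read backwards, by cases on `ord c′`).
* §3 `mem_span_pow_iff_map_mem_span_pow` ∕ `level_iff_level_map`: the same level statement descends to `𝒪_F` along the unramified dictionary `ιO` (`σO`-fixed elements come
  from `F`, `ιO ϖ_F = ϖ`), i.e. ★ (UG)'s `hlvl` for `c′ = ιO y` verbatim.

References: [Neukirch1999] J. Neukirch, *Algebraic Number Theory*, Grundlehren 322 (1999), Ch. I §12 (orders, conductors; invertible = locally principal ideals);
[SerreLocalFields1979] J.-P. Serre, *Local Fields*, GTM 67 (1979), Ch. I §6 Prop. 17–18 (Eisenstein equations, valuations of `x² − tx + d`); [Bass1963] H. Bass, *On the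
ubiquity of Gorenstein rings*, Math. Z. 82 (1963), §7 (principal ideals of Gorenstein orders); [Rogawski1990] J. Rogawski, *Automorphic representations of unitary groups in
three variables*, §4.9 Lemma 4.9.3 p. 56 (the levels `(N, n)` of the type-(2) count).
-/

set_option autoImplicit false

noncomputable section

open scoped ValuativeRel
open ValuativeRel

namespace Literature.NumberTheory.Automorphic

variable {E : Type*} [Field E] [ValuativeRel E] {O₁ : Type*} [CommRing O₁] (j : 𝒪[E] →+* O₁) (θ : O₁) {a k : 𝒪[E]}
  (hθ : θ * θ = j a * θ + j k) (hcoord : ∀ z : O₁, ∃! bc : 𝒪[E] × 𝒪[E], z = j bc.1 + j bc.2 * θ)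

/-! ## §1 Principal slice ⇒ exact level -/

include hθ in
/-- The Eisenstein multiplication table in coordinates: `(x + yθ)(x′ + y′θ) = (xx′ + yy′k) + (xy′ + yx′ + yy′a)θ`. [cite: SerreLocalFields1979, Ch. I §6 Prop. 17–18] -/
theorem coord_mul_coord (x y x' y' : 𝒪[E]) :
    (j x + j y * θ) * (j x' + j y' * θ) = j (x * x' + y * y' * k) + j (x * y' + y * x' + y * y' * a) * θ := by
  have h : (j x + j y * θ) * (j x' + j y' * θ) = j x * j x' + (j x * j y' + j y * j x') * θ + j y * j y' * (θ * θ) := by ring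
  rw [h, hθ]
  simp only [map_add, map_mul]
  ring

include hcoord in
/-- `j(π^m)` is a non-zero-divisor of `O₁ = j𝒪 ⊕ j𝒪θ` (`𝒪` a domain, `ϖ ≠ 0`). [cite: SerreLocalFields1979, Ch. I §6] -/
theorem eq_zero_of_map_pow_mul_eq_zero {ϖ : E} (hϖ : IsUniformizingElement ϖ) (m : ℕ) {t : O₁}
    (ht : j ((⟨ϖ, hϖ.mem⟩ : 𝒪[E]) ^ m) * t = 0) : t = 0 := by
  have hπ0 : (⟨ϖ, hϖ.mem⟩ : 𝒪[E]) ≠ 0 := fun h => hϖ.ne_zero (congrArg Subtype.val h)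
  obtain ⟨⟨p, q⟩, hpq, -⟩ := hcoord t
  simp only at hpq
  have h : j ((⟨ϖ, hϖ.mem⟩ : 𝒪[E]) ^ m * p) + j ((⟨ϖ, hϖ.mem⟩ : 𝒪[E]) ^ m * q) * θ = j 0 + j 0 * θ := by
    rw [map_zero, zero_mul, add_zero, ← ht, hpq, map_mul, map_mul]; ring
  obtain ⟨hp, hq⟩ := coord_unique j θ hcoord h
  rw [hpq, (mul_eq_zero.1 hp).resolve_left (pow_ne_zero _ hπ0), (mul_eq_zero.1 hq).resolve_left (pow_ne_zero _ hπ0), map_zero,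
    zero_mul, add_zero]

/-- Lawful at a level `b ≥ 1` forces `c′ ∈ 𝔪` (`c′² ≡ π^{N″}a c′ + π^{2N″}k ∈ 𝔪`, `𝔪` prime). [cite: SerreLocalFields1979, Ch. I §6 Prop. 17–18] -/
theorem mem_maximalIdeal_of_lawful {ϖ : E} (hϖ : IsUniformizingElement ϖ) (ha : a ∈ IsLocalRing.maximalIdeal 𝒪[E]) (hk : k ∈ IsLocalRing.maximalIdeal 𝒪[E])
    {N'' b : ℕ} (hb : 1 ≤ b) {c' : 𝒪[E]}
    (hlaw : c' * c' - ((⟨ϖ, hϖ.mem⟩ : 𝒪[E]) ^ N'' * a * c' + (⟨ϖ, hϖ.mem⟩ : 𝒪[E]) ^ (2 * N'') * k) ∈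
      Ideal.span ({(⟨ϖ, hϖ.mem⟩ : 𝒪[E]) ^ b} : Set 𝒪[E])) :
    c' ∈ IsLocalRing.maximalIdeal 𝒪[E] := by
  set 𝔪 := IsLocalRing.maximalIdeal 𝒪[E] with h𝔪
  have h1 : c' * c' - ((⟨ϖ, hϖ.mem⟩ : 𝒪[E]) ^ N'' * a * c' + (⟨ϖ, hϖ.mem⟩ : 𝒪[E]) ^ (2 * N'') * k) ∈ 𝔪 :=
    span_uniformizer_pow_le_maximalIdeal hϖ hb hlaw
  have h2 : (⟨ϖ, hϖ.mem⟩ : 𝒪[E]) ^ N'' * a * c' + (⟨ϖ, hϖ.mem⟩ : 𝒪[E]) ^ (2 * N'') * k ∈ 𝔪 :=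
    𝔪.add_mem (𝔪.mul_mem_right _ (𝔪.mul_mem_left _ ha)) (𝔪.mul_mem_left _ hk)
  have h3 : c' * c' ∈ 𝔪 := by simpa using 𝔪.add_mem h1 h2
  exact ((IsLocalRing.maximalIdeal.isMaximal 𝒪[E]).isPrime.mem_or_mem h3).elim id id

include hθ hcoord in
/-- **PRINCIPAL SLICE ⇒ EXACT LEVEL.**  For the glued over-order `G = G(N″, b, c′)` with `b ≥ 1` and LAWFUL `c′`: if the `O₁`-slice `{s | (0, s) ∈ G}` (= `ker χ`) is
PRINCIPAL — `{s | (0, s) ∈ G} = {g.2·ν | g ∈ G}` for some `ν` (★ F3-2b (B3b) read in `𝒪_E × O₁`) — then the character value has EXACT level: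
`v(c′² − (π^{N″}a c′ + π^{2N″}k)) = v(ϖ)^b`. [cite: Bass1963, §7] [cite: Neukirch1999, Ch. I §12] [cite: SerreLocalFields1979, Ch. I §6 Prop. 17–18] -/
theorem valuation_char_eq_of_slice_principal {ϖ : E} (hϖ : IsUniformizingElement ϖ) (ha : a ∈ IsLocalRing.maximalIdeal 𝒪[E])
    (hk : k ∈ IsLocalRing.maximalIdeal 𝒪[E]) {N'' b : ℕ} (hb : 1 ≤ b) {c' : 𝒪[E]}
    (hlaw : c' * c' - ((⟨ϖ, hϖ.mem⟩ : 𝒪[E]) ^ N'' * a * c' + (⟨ϖ, hϖ.mem⟩ : 𝒪[E]) ^ (2 * N'') * k) ∈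
      Ideal.span ({(⟨ϖ, hϖ.mem⟩ : 𝒪[E]) ^ b} : Set 𝒪[E]))
    (hprin : ∃ ν : O₁,
      {s : O₁ | ((0 : 𝒪[E]), s) ∈ {z : 𝒪[E] × O₁ | ∃ b₀ c₀ : 𝒪[E], z.2 = j b₀ + j c₀ * (j ((⟨ϖ, hϖ.mem⟩ : 𝒪[E]) ^ N'') * θ) ∧
          z.1 - (b₀ + c₀ * c') ∈ Ideal.span ({(⟨ϖ, hϖ.mem⟩ : 𝒪[E]) ^ b} : Set 𝒪[E])}} =
        (fun g : 𝒪[E] × O₁ => g.2 * ν) '' {z : 𝒪[E] × O₁ | ∃ b₀ c₀ : 𝒪[E], z.2 = j b₀ + j c₀ * (j ((⟨ϖ, hϖ.mem⟩ : 𝒪[E]) ^ N'') * θ) ∧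
          z.1 - (b₀ + c₀ * c') ∈ Ideal.span ({(⟨ϖ, hϖ.mem⟩ : 𝒪[E]) ^ b} : Set 𝒪[E])}) :
    valuation E ((c' * c' - ((⟨ϖ, hϖ.mem⟩ : 𝒪[E]) ^ N'' * a * c' + (⟨ϖ, hϖ.mem⟩ : 𝒪[E]) ^ (2 * N'') * k) : 𝒪[E]) : E) =
      valuation E ϖ ^ b := by
  classical
  set π : 𝒪[E] := ⟨ϖ, hϖ.mem⟩ with hπ
  set P : O₁ := j (π ^ N'') * θ with hP
  set f : 𝒪[E] := c' * c' - (π ^ N'' * a * c' + π ^ (2 * N'') * k) with hf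
  set G : Set (𝒪[E] × O₁) := {z : 𝒪[E] × O₁ | ∃ b₀ c₀ : 𝒪[E], z.2 = j b₀ + j c₀ * P ∧ z.1 - (b₀ + c₀ * c') ∈ Ideal.span ({π ^ b} : Set 𝒪[E])}
    with hG
  set 𝔪 := IsLocalRing.maximalIdeal 𝒪[E] with h𝔪
  have hπ0 : π ≠ 0 := fun h => hϖ.ne_zero (congrArg Subtype.val h)
  have hc'm : c' ∈ 𝔪 := mem_maximalIdeal_of_lawful hϖ ha hk hb hlaw
  have hπbm : π ^ b ∈ 𝔪 := span_uniformizer_pow_le_maximalIdeal hϖ hb (Ideal.mem_span_singleton_self _)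
  obtain ⟨ν, hν⟩ := hprin
  -- reading the slice equation
  have hslice : ∀ s : O₁, ((0 : 𝒪[E]), s) ∈ G ↔ ∃ g ∈ G, g.2 * ν = s := fun s => by
    have h := Set.ext_iff.1 hν s
    simp only [Set.mem_setOf_eq, Set.mem_image] at h
    exact h
  -- normal form of `j x + j y P`
  have hnf : ∀ x y : 𝒪[E], j x + j y * P = j x + j (y * π ^ N'') * θ := fun x y => by rw [hP, map_mul]; ring
  -- (1) `j(π^b)` and (2) `P − j c′` lie in the slice; (3) so does `ν`
  have h1G : ((0 : 𝒪[E]), j (π ^ b)) ∈ G := ⟨π ^ b, 0, by simp, by simp⟩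
  have h2G : ((0 : 𝒪[E]), P - j c') ∈ G := ⟨-c', 1, by rw [map_neg, map_one, one_mul]; ring, by simp⟩
  obtain ⟨g₁, hg₁G, hg₁⟩ := (hslice _).1 h1G
  obtain ⟨g₂, hg₂G, hg₂⟩ := (hslice _).1 h2G
  obtain ⟨x₁, y₁, hg₁2, -⟩ := hg₁G
  obtain ⟨x₂, y₂, hg₂2, -⟩ := hg₂G
  have hνG : ((0 : 𝒪[E]), ν) ∈ G := by
    refine (hslice ν).2 ⟨((1 : 𝒪[E]), j 1 + j 0 * P), ⟨1, 0, rfl, by simp⟩, ?_⟩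
    simp
  obtain ⟨β, γ, hνβγ, hβγ⟩ := hνG
  simp only at hνβγ hβγ
  rw [zero_sub, Ideal.neg_mem_iff] at hβγ
  obtain ⟨e, he⟩ := Ideal.mem_span_singleton'.1 hβγ
  -- (4) `ν` is a non-zero-divisor; (5) `ν = (j e s₁ + j γ s₂) ν`, so `j e s₁ + j γ s₂ = 1`
  have hw : j e * g₁.2 + j γ * g₂.2 = 1 := by
    have hνeq : ν = (j e * g₁.2 + j γ * g₂.2) * ν := by
      have h : (j e * g₁.2 + j γ * g₂.2) * ν = j e * (g₁.2 * ν) + j γ * (g₂.2 * ν) := by ring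
      rw [h, hg₁, hg₂, hνβγ]
      have hβ : β = e * π ^ b - γ * c' := by rw [he]; ring
      rw [hβ]
      simp only [map_sub, map_mul]
      ring
    have h0 : j (π ^ b) * (1 - (j e * g₁.2 + j γ * g₂.2)) = 0 := by
      rw [← hg₁]
      have : g₁.2 * ν * (1 - (j e * g₁.2 + j γ * g₂.2)) = g₁.2 * (ν - (j e * g₁.2 + j γ * g₂.2) * ν) := by ring
      rw [this, ← hνeq, sub_self, mul_zero]
    have h := eq_zero_of_map_pow_mul_eq_zero j θ hcoord hϖ b h0
    exact (sub_eq_zero.1 h).symm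
  -- first coordinates: `e x₁ + γ x₂ = 1`
  have hx : e * x₁ + γ * x₂ = 1 := by
    have h : j (e * x₁ + γ * x₂) + j ((e * y₁ + γ * y₂) * π ^ N'') * θ = j 1 + j 0 * θ := by
      rw [map_one, map_zero, zero_mul, add_zero, ← hw, hg₁2, hg₂2, hnf, hnf]
      simp only [map_add, map_mul]
      ring
    exact (coord_unique j θ hcoord h).1
  -- (7) the relation `s₂ j(π^b) = s₁ (P − j c′)` in coordinates
  have hrel : g₂.2 * j (π ^ b) = g₁.2 * (P - j c') := by
    rw [← hg₁, ← hg₂]; ring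
  have hE : j (x₂ * π ^ b) + j (y₂ * π ^ N'' * π ^ b) * θ =
      j (x₁ * -c' + y₁ * π ^ N'' * π ^ N'' * k) + j (x₁ * π ^ N'' + y₁ * π ^ N'' * -c' + y₁ * π ^ N'' * π ^ N'' * a) * θ := by
    have hl : g₂.2 * j (π ^ b) = j (x₂ * π ^ b) + j (y₂ * π ^ N'' * π ^ b) * θ := by
      rw [hg₂2, hnf]; simp only [map_mul]; ring
    have hr : g₁.2 * (P - j c') = j (x₁ * -c' + y₁ * π ^ N'' * π ^ N'' * k) + j (x₁ * π ^ N'' + y₁ * π ^ N'' * -c' + y₁ * π ^ N'' * π ^ N'' * a) * θ := by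
      have hPc : P - j c' = j (-c') + j (π ^ N'') * θ := by rw [hP, map_neg]; ring
      rw [hg₁2, hnf, hPc, coord_mul_coord j θ hθ]
    rw [← hl, ← hr, hrel]
  obtain ⟨hE1, hE2⟩ := coord_unique j θ hcoord hE
  have hE2' : y₂ * π ^ b = x₁ - y₁ * c' + y₁ * π ^ N'' * a := by
    have h : (y₂ * π ^ b) * π ^ N'' = (x₁ - y₁ * c' + y₁ * π ^ N'' * a) * π ^ N'' := by linear_combination hE2
    exact mul_right_cancel₀ (pow_ne_zero _ hπ0) h
  have key : y₁ * f = -(π ^ b * (x₂ + c' * y₂)) := by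
    rw [hf]; linear_combination hE1 + c' * hE2'
  -- (8) `x₁` is not a unit (else `x₁ ∈ 𝔪`), so `x₂` is
  have hx₁ : ¬ IsUnit x₁ := fun hu => by
    have hm : x₁ ∈ 𝔪 := by
      have h : x₁ = y₂ * π ^ b + y₁ * c' - y₁ * (π ^ N'' * a) := by linear_combination (-1 : 𝒪[E]) * hE2'
      rw [h]
      exact 𝔪.sub_mem (𝔪.add_mem (𝔪.mul_mem_left _ hπbm) (𝔪.mul_mem_left _ hc'm)) (𝔪.mul_mem_left _ (𝔪.mul_mem_left _ ha))
    exact (IsLocalRing.mem_maximalIdeal _).1 hm hu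
  have hx₂ : IsUnit x₂ := by
    by_contra hnu
    have h1 : e * x₁ + γ * x₂ ∈ 𝔪 := 𝔪.add_mem (𝔪.mul_mem_left _ ((IsLocalRing.mem_maximalIdeal _).2 hx₁)) (𝔪.mul_mem_left _ ((IsLocalRing.mem_maximalIdeal _).2 hnu))
    rw [hx] at h1
    exact (IsLocalRing.maximalIdeal.isMaximal 𝒪[E]).ne_top (Ideal.eq_top_of_isUnit_mem _ h1 isUnit_one)
  have hx₂' : IsUnit (x₂ + c' * y₂) := by
    obtain ⟨u, hu⟩ := hx₂
    have h : (x₂ + c' * y₂) * ↑u⁻¹ - 1 ∈ 𝔪 := by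
      have h' : (x₂ + c' * y₂) * ↑u⁻¹ - 1 = c' * y₂ * ↑u⁻¹ := by rw [← hu, add_mul, Units.mul_inv, add_sub_cancel_left]
      rw [h']; exact 𝔪.mul_mem_right _ (𝔪.mul_mem_right _ hc'm)
    have h2 := isUnit_of_sub_one_mem_maximalIdeal h
    exact (Units.isUnit_mul_units _ u⁻¹).1 h2
  -- (9) valuations
  have hv0 : valuation E ϖ ≠ 0 := (Valuation.ne_zero_iff _).2 hϖ.ne_zero
  have hvf_le : valuation E (f : E) ≤ valuation E ϖ ^ b := (mem_span_uniformizer_pow_iff_valuation_le hϖ f b).1 hlaw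
  have hprod : valuation E (y₁ : E) * valuation E (f : E) = valuation E ϖ ^ b := by
    have h := congrArg (fun z : 𝒪[E] => valuation E (z : E)) key
    simp only [Subring.coe_mul, Subring.coe_neg, SubmonoidClass.coe_pow, map_mul, Valuation.map_neg, map_pow] at h
    rw [h, valuation_coe_eq_one_of_isUnit hx₂', mul_one]
  have hy₁ : valuation E (y₁ : E) ≤ 1 := (Valuation.mem_integer_iff _ _).1 y₁.2
  refine le_antisymm hvf_le ?_
  calc valuation E ϖ ^ b = valuation E (y₁ : E) * valuation E (f : E) := hprod.symm
    _ ≤ valuation E (f : E) := mul_le_of_le_one_left' hy₁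

/-! ## §2 Exact level ⇒ the monogenic levels `Lvl(N″, b, c′)` -/

/-- **EXACT LEVEL ⇒ `Lvl`.**  In a discrete valuation ring with uniformiser `ϖ`, `a ∈ 𝔪`, `v(k) = v(ϖ)`: if `v(c′² − (π^{N″}a c′ + π^{2N″}k)) = v(ϖ)^b` with `b ≥ 1` then EITHER
`b = 2N″+1` and `c′ ∈ (π^{N″+1})` (the constant term dominates) OR `b = 2M`, `1 ≤ M ≤ N″`, `c′ ∈ (π^M) ∖ (π^{M+1})` (the square dominates) — ★ F3-3 FILE 1's value laws read
backwards by cases on `ord c′`; this is ★ (UG) `exists_unitary_generator_glued`'s `hlvl` in `𝒪_E`-currency. [cite: SerreLocalFields1979, Ch. I §6 Prop. 17–18]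
[cite: Rogawski1990, §4.9 Lemma 4.9.3 p. 56] -/
theorem level_of_valuation_char_eq [IsDiscreteValuationRing 𝒪[E]] {ϖ : E} (hϖ : IsUniformizingElement ϖ) {a k c' : 𝒪[E]}
    (ha : a ∈ IsLocalRing.maximalIdeal 𝒪[E]) (hk₁ : valuation E (k : E) = valuation E ϖ) {N'' b : ℕ} (hb : 1 ≤ b)
    (hval : valuation E ((c' * c' - ((⟨ϖ, hϖ.mem⟩ : 𝒪[E]) ^ N'' * a * c' + (⟨ϖ, hϖ.mem⟩ : 𝒪[E]) ^ (2 * N'') * k) : 𝒪[E]) : E) =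
      valuation E ϖ ^ b) :
    (b = 2 * N'' + 1 ∧ c' ∈ Ideal.span ({(⟨ϖ, hϖ.mem⟩ : 𝒪[E]) ^ (N'' + 1)} : Set 𝒪[E])) ∨
      ∃ M : ℕ, 1 ≤ M ∧ M ≤ N'' ∧ b = 2 * M ∧ c' ∈ Ideal.span ({(⟨ϖ, hϖ.mem⟩ : 𝒪[E]) ^ M} : Set 𝒪[E]) ∧
        c' ∉ Ideal.span ({(⟨ϖ, hϖ.mem⟩ : 𝒪[E]) ^ (M + 1)} : Set 𝒪[E]) := by
  classical
  set π : 𝒪[E] := ⟨ϖ, hϖ.mem⟩ with hπ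
  have hπ0 : π ≠ 0 := fun h => hϖ.ne_zero (congrArg Subtype.val h)
  have hv0 : valuation E ϖ ≠ 0 := (Valuation.ne_zero_iff _).2 hϖ.ne_zero
  have hv1 : valuation E ϖ < 1 := hϖ.valuation_lt_one
  have hinj : Function.Injective fun n : ℕ => valuation E ϖ ^ n := (pow_right_strictAnti₀ (zero_lt_iff.2 hv0) hv1).injective
  have hk : k ∈ IsLocalRing.maximalIdeal 𝒪[E] := by
    rw [hϖ.span_eq]
    simpa only [pow_one] using (mem_span_uniformizer_pow_iff_valuation_le hϖ k 1).2 (by rw [pow_one, hk₁])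
  -- rewrite `f(c′)` in ★ FILE 1's spelling
  have hsp : ∀ x : 𝒪[E], x * x - π ^ N'' * a * x - π ^ (2 * N'') * k = x * x - (π ^ N'' * a * x + π ^ (2 * N'') * k) := fun x => by ring
  by_cases hc'N : c' ∈ Ideal.span ({π ^ (N'' + 1)} : Set 𝒪[E])
  · -- odd level
    left
    refine ⟨hinj ?_, hc'N⟩
    have h := (char_and_valuation_eq_of_odd_level hϖ ha hk₁ hc'N).2 c' (by simp)
    rw [hsp] at h
    exact (hval.symm.trans h)
  · right
    have hc'0 : c' ≠ 0 := fun h => hc'N (by rw [h]; exact Ideal.zero_mem _)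
    obtain ⟨m, u, hu⟩ := IsDiscreteValuationRing.associated_pow_irreducible hc'0
      (IsDiscreteValuationRing.irreducible_of_span_eq_maximalIdeal π hπ0 hϖ.span_eq)
    -- `c′ = π^m u`, `v(c′) = v(ϖ)^m`
    have hc'v : valuation E (c' : E) = valuation E ϖ ^ m := by
      have h := congrArg (fun z : 𝒪[E] => valuation E (z : E)) hu
      simp only [Subring.coe_mul, SubmonoidClass.coe_pow, map_mul, map_pow, valuation_coe_eq_one_of_isUnit (Units.isUnit u),
        mul_one] at h
      exact h
    have hmN : m ≤ N'' := by
      by_contra hlt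
      push Not at hlt
      apply hc'N
      refine (mem_span_uniformizer_pow_iff_valuation_le hϖ c' (N'' + 1)).2 ?_
      rw [hc'v]
      exact pow_le_pow_right_of_le_one' hv1.le (by omega)
    have hm1 : 1 ≤ m := by
      by_contra hlt
      push Not at hlt
      have hm0 : m = 0 := by omega
      -- `c′` a unit ⇒ `f(c′)` a unit ⇒ `b = 0`
      have hcu : IsUnit c' := IsUnit.of_mul_eq_one (↑u) (by rw [hu, hm0, pow_zero])
      have hfu : IsUnit (c' * c' - (π ^ N'' * a * c' + π ^ (2 * N'') * k)) := by
        obtain ⟨w, hw⟩ := hcu.mul hcu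
        have hm : (c' * c' - (π ^ N'' * a * c' + π ^ (2 * N'') * k)) * ↑w⁻¹ - 1 ∈ IsLocalRing.maximalIdeal 𝒪[E] := by
          have h' : (c' * c' - (π ^ N'' * a * c' + π ^ (2 * N'') * k)) * ↑w⁻¹ - 1 = -((π ^ N'' * a * c' + π ^ (2 * N'') * k) * ↑w⁻¹) := by
            rw [← hw, sub_mul, Units.mul_inv]; ring
          rw [h', Ideal.neg_mem_iff]
          exact Ideal.mul_mem_right _ _ (Ideal.add_mem _ (Ideal.mul_mem_right _ _ (Ideal.mul_mem_left _ _ ha)) (Ideal.mul_mem_left _ _ hk))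
        exact (Units.isUnit_mul_units _ w⁻¹).1 (isUnit_of_sub_one_mem_maximalIdeal hm)
      have h1 : valuation E ϖ ^ b = valuation E ϖ ^ 0 := by rw [pow_zero, ← hval, valuation_coe_eq_one_of_isUnit hfu]
      have := hinj h1
      omega
    refine ⟨m, hm1, hmN, hinj ?_, mem_span_uniformizer_pow_of_valuation_eq hϖ hc'v, fun hmem => ?_⟩
    · have h := (char_and_valuation_eq_of_even_level hϖ ha hk hm1 hmN hc'v).2 c' (by simp)
      rw [hsp] at h
      exact hval.symm.trans h
    · have hle := (mem_span_uniformizer_pow_iff_valuation_le hϖ c' (m + 1)).1 hmem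
      rw [hc'v] at hle
      exact absurd hle (not_le.2 (pow_lt_pow_right_of_lt_one₀ (zero_lt_iff.2 hv0) hv1 (Nat.lt_succ_self m)))

/-! ## §3 Descent of the level to `𝒪_F` along the unramified dictionary -/

section Descent

variable {F : Type*} [Field F] [ValuativeRel F] (ιO : 𝒪[F] →+* 𝒪[E]) (σO : 𝒪[E] →+* 𝒪[E])

include hcoord in
omit hcoord in
/-- **`ιO y ∈ (ϖ^m) ↔ y ∈ (ϖ_F^m)`** along the unramified dictionary (`ιO` injective with `ιO ϖ_F = ϖ`, `σO ∘ ιO = ιO`, `σO`-fixed elements come from `F`): the quotient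
`z = ιO y ∕ ϖ^m` is `σO`-fixed (`𝒪_E` a domain), hence in the image. [cite: SerreLocalFields1979, Ch. I §6] -/
theorem map_mem_span_pow_iff (hσι : ∀ y, σO (ιO y) = ιO y) (hfixO : ∀ x, σO x = x → ∃ y, ιO y = x) (hιinj : Function.Injective ιO)
    {ϖF : F} {ϖ : E} (hϖF : IsUniformizingElement ϖF) (hϖ : IsUniformizingElement ϖ) (hιϖ : ιO ⟨ϖF, hϖF.mem⟩ = ⟨ϖ, hϖ.mem⟩)
    (y : 𝒪[F]) (m : ℕ) :
    ιO y ∈ Ideal.span ({(⟨ϖ, hϖ.mem⟩ : 𝒪[E]) ^ m} : Set 𝒪[E]) ↔ y ∈ Ideal.span ({(⟨ϖF, hϖF.mem⟩ : 𝒪[F]) ^ m} : Set 𝒪[F]) := by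
  have hπ0 : (⟨ϖ, hϖ.mem⟩ : 𝒪[E]) ≠ 0 := fun h => hϖ.ne_zero (congrArg Subtype.val h)
  constructor
  · intro h
    obtain ⟨z, hz⟩ := Ideal.mem_span_singleton'.1 h
    -- `z` is `σO`-fixed
    have hσπ : σO ((⟨ϖ, hϖ.mem⟩ : 𝒪[E]) ^ m) = (⟨ϖ, hϖ.mem⟩ : 𝒪[E]) ^ m := by rw [map_pow, ← hιϖ, hσι]
    have hzfix : σO z = z := by
      have h1 : σO z * (⟨ϖ, hϖ.mem⟩ : 𝒪[E]) ^ m = z * (⟨ϖ, hϖ.mem⟩ : 𝒪[E]) ^ m := by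
        have := congrArg σO hz
        rw [map_mul, hσπ, hσι] at this
        rw [this, hz]
      exact mul_right_cancel₀ (pow_ne_zero _ hπ0) h1
    obtain ⟨z₀, hz₀⟩ := hfixO z hzfix
    refine Ideal.mem_span_singleton'.2 ⟨z₀, hιinj ?_⟩
    rw [map_mul, map_pow, hιϖ, hz₀, hz]
  · exact map_mem_span_pow_of_mem_span_pow ιO hϖF hϖ hιϖ

/-- **THE LEVEL DESCENDS TO `𝒪_F`**: for `c′ = ιO y`, ★ (UG)'s `hlvl` in `𝒪_F`-currency (`y`, `ϖ_F`) is equivalent to the `𝒪_E`-currency level of §2.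
[cite: SerreLocalFields1979, Ch. I §6] [cite: Rogawski1990, §4.9 Lemma 4.9.3 p. 56] -/
theorem level_map_iff (hσι : ∀ y, σO (ιO y) = ιO y) (hfixO : ∀ x, σO x = x → ∃ y, ιO y = x) (hιinj : Function.Injective ιO)
    {ϖF : F} {ϖ : E} (hϖF : IsUniformizingElement ϖF) (hϖ : IsUniformizingElement ϖ) (hιϖ : ιO ⟨ϖF, hϖF.mem⟩ = ⟨ϖ, hϖ.mem⟩)
    (y : 𝒪[F]) (N'' b : ℕ) :
    ((b = 2 * N'' + 1 ∧ ιO y ∈ Ideal.span ({(⟨ϖ, hϖ.mem⟩ : 𝒪[E]) ^ (N'' + 1)} : Set 𝒪[E])) ∨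
      ∃ M : ℕ, 1 ≤ M ∧ M ≤ N'' ∧ b = 2 * M ∧ ιO y ∈ Ideal.span ({(⟨ϖ, hϖ.mem⟩ : 𝒪[E]) ^ M} : Set 𝒪[E]) ∧
        ιO y ∉ Ideal.span ({(⟨ϖ, hϖ.mem⟩ : 𝒪[E]) ^ (M + 1)} : Set 𝒪[E])) ↔
    ((b = 2 * N'' + 1 ∧ y ∈ Ideal.span ({(⟨ϖF, hϖF.mem⟩ : 𝒪[F]) ^ (N'' + 1)} : Set 𝒪[F])) ∨
      ∃ M : ℕ, 1 ≤ M ∧ M ≤ N'' ∧ b = 2 * M ∧ y ∈ Ideal.span ({(⟨ϖF, hϖF.mem⟩ : 𝒪[F]) ^ M} : Set 𝒪[F]) ∧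
        y ∉ Ideal.span ({(⟨ϖF, hϖF.mem⟩ : 𝒪[F]) ^ (M + 1)} : Set 𝒪[F])) := by
  simp only [map_mem_span_pow_iff ιO σO hσι hfixO hιinj hϖF hϖ hιϖ]

end Descent

include hθ hcoord in
/-- **PRINCIPAL SLICE ⇒ `Lvl` (assembled)**: for `G(N″, b, c′)` with `b ≥ 1`, `c′` lawful and principal `O₁`-slice, in a DVR with `a ∈ 𝔪`, `v(k) = v(ϖ)`, the pair `(b, c′)` is at a
monogenic level: `(b = 2N″+1 ∧ c′ ∈ (π^{N″+1})) ∨ (∃ M, 1 ≤ M ≤ N″, b = 2M, c′ ∈ (π^M) ∖ (π^{M+1}))`. [cite: Bass1963, §7] [cite: SerreLocalFields1979, Ch. I §6 Prop. 17–18]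
[cite: Rogawski1990, §4.9 Lemma 4.9.3 p. 56] -/
theorem level_of_slice_principal [IsDiscreteValuationRing 𝒪[E]] {ϖ : E} (hϖ : IsUniformizingElement ϖ) (ha : a ∈ IsLocalRing.maximalIdeal 𝒪[E])
    (hk₁ : valuation E (k : E) = valuation E ϖ) {N'' b : ℕ} (hb : 1 ≤ b) {c' : 𝒪[E]}
    (hlaw : c' * c' - ((⟨ϖ, hϖ.mem⟩ : 𝒪[E]) ^ N'' * a * c' + (⟨ϖ, hϖ.mem⟩ : 𝒪[E]) ^ (2 * N'') * k) ∈
      Ideal.span ({(⟨ϖ, hϖ.mem⟩ : 𝒪[E]) ^ b} : Set 𝒪[E]))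
    (hprin : ∃ ν : O₁,
      {s : O₁ | ((0 : 𝒪[E]), s) ∈ {z : 𝒪[E] × O₁ | ∃ b₀ c₀ : 𝒪[E], z.2 = j b₀ + j c₀ * (j ((⟨ϖ, hϖ.mem⟩ : 𝒪[E]) ^ N'') * θ) ∧
          z.1 - (b₀ + c₀ * c') ∈ Ideal.span ({(⟨ϖ, hϖ.mem⟩ : 𝒪[E]) ^ b} : Set 𝒪[E])}} =
        (fun g : 𝒪[E] × O₁ => g.2 * ν) '' {z : 𝒪[E] × O₁ | ∃ b₀ c₀ : 𝒪[E], z.2 = j b₀ + j c₀ * (j ((⟨ϖ, hϖ.mem⟩ : 𝒪[E]) ^ N'') * θ) ∧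
          z.1 - (b₀ + c₀ * c') ∈ Ideal.span ({(⟨ϖ, hϖ.mem⟩ : 𝒪[E]) ^ b} : Set 𝒪[E])}) :
    (b = 2 * N'' + 1 ∧ c' ∈ Ideal.span ({(⟨ϖ, hϖ.mem⟩ : 𝒪[E]) ^ (N'' + 1)} : Set 𝒪[E])) ∨
      ∃ M : ℕ, 1 ≤ M ∧ M ≤ N'' ∧ b = 2 * M ∧ c' ∈ Ideal.span ({(⟨ϖ, hϖ.mem⟩ : 𝒪[E]) ^ M} : Set 𝒪[E]) ∧
        c' ∉ Ideal.span ({(⟨ϖ, hϖ.mem⟩ : 𝒪[E]) ^ (M + 1)} : Set 𝒪[E]) := by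
  have hk : k ∈ IsLocalRing.maximalIdeal 𝒪[E] := by
    rw [hϖ.span_eq]
    simpa only [pow_one] using (mem_span_uniformizer_pow_iff_valuation_le hϖ k 1).2 (by rw [pow_one, hk₁])
  exact level_of_valuation_char_eq hϖ ha hk₁ hb (valuation_char_eq_of_slice_principal j θ hθ hcoord hϖ ha hk hb hlaw hprin)

end Literature.NumberTheory.Automorphic

end
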